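import Mathlib
import HarnessLib

/-!
# Crux `NoFrozenEddyCollapse` (stmt-NavierStokesRegularity-1431), line `SketchIdeator1`:
  STUB `stub_logWindow` (the abstract log-window lemma)

Helper file (lands `--supports stmt-NavierStokesRegularity-1431`) for the registered stub
`stub_logWindow` of the skeleton `NoFrozenEddyCollapse` (card `shell-balance-edge-torsion`).
Pure one-variable real analysis, no PDE: if `G` is bounded on `(T₀, T)` and differentiable there
with `G′(t) = q(t) + (ℓ(T−t))⁻¹ c(t)`, `q, c` continuous on `(T₀, T)`, `|q| ≤ K ρ` with `ρ`
integrable on `(T₀, T)`, and `c(t) → c₀` as `t ↑ T`, then `c₀ = 0`.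

Proof outline.  Suppose `c₀ > 0` (the case `c₀ < 0` follows by negating `G, q, c`).  Late in the
window `c ≥ c₀/2`, say on `(l, T)`.  Fix `t₁ ∈ (max T₀ l, T)` and put `t₂ = T − (T − t₁) e^{−N}`.
The fundamental theorem of calculus on `[t₁, t₂] ⊂ (T₀, T)` gives
`G t₂ − G t₁ = ∫_{t₁}^{t₂} q + ∫_{t₁}^{t₂} (ℓ(T−t))⁻¹ c`; the first integral is at least
`−C`, `C = ∫_{(T₀,T)} K ρ` (as `|q| ≤ Kρ` pointwise and `Kρ ≥ 0`), the second at least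
`(c₀/2) ℓ⁻¹ ∫_{t₁}^{t₂} (T−t)⁻¹ dt = (c₀/2) ℓ⁻¹ N` (antiderivative `−log (T−t)`).  Choosing `N ∈ ℕ`
with `(c₀/2) ℓ⁻¹ N > 2M + C + 1` contradicts `|G| ≤ M`.  Mathlib only.
-/

noncomputable section

open MeasureTheory Set Filter Topology Metric Function

namespace Summit.NavierStokesRegularity.NavierStokesRegularity.Theorems.NoFrozenEddyCollapse.ShellBalanceEdgeTorsion

/-- `∫_{t₁}^{t₂} (T − t)⁻¹ dt = log (T − t₁) − log (T − t₂)` for `t₁ ≤ t₂ < T`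
(FTC with the antiderivative `t ↦ −log (T − t)`, whose derivative `(T − t)⁻¹` is continuous on
`[t₁, t₂]`). -/
private theorem integral_inv_sub_eq_log {T t₁ t₂ : ℝ} (h12 : t₁ ≤ t₂) (h2 : t₂ < T) :
    ∫ t in t₁..t₂, (T - t)⁻¹ = Real.log (T - t₁) - Real.log (T - t₂) := by
  have hderiv : ∀ t ∈ uIcc t₁ t₂, HasDerivAt (fun s : ℝ => -Real.log (T - s)) ((T - t)⁻¹) t := by
    intro t ht
    rw [uIcc_of_le h12] at ht
    have hTt : 0 < T - t := by linarith [ht.2]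
    have h1 : HasDerivAt (fun s : ℝ => T - s) (-1) t := (hasDerivAt_id' t).const_sub T
    have h2 : HasDerivAt (fun s : ℝ => Real.log (T - s)) ((-1) / (T - t)) t := h1.log hTt.ne'
    exact h2.fun_neg.congr_deriv (by ring)
  have hint : IntervalIntegrable (fun t : ℝ => (T - t)⁻¹) volume t₁ t₂ := by
    refine ContinuousOn.intervalIntegrable_of_Icc h12 ?_
    refine ContinuousOn.inv₀ (by fun_prop) ?_
    intro t ht
    have hTt : 0 < T - t := by linarith [ht.2]
    exact hTt.ne'
  rw [intervalIntegral.integral_eq_sub_of_hasDerivAt hderiv hint]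
  ring

/-- The case `0 < c₀` of `stub_logWindow` is contradictory: with `c ≥ c₀/2` on a late window
`(l, T)`, `t₁ ∈ (max T₀ l, T)` and `t₂ = T − (T − t₁)e^{−N}`, the FTC identity
`G t₂ − G t₁ = ∫_{t₁}^{t₂} q + ∫_{t₁}^{t₂} (ℓ(T−t))⁻¹ c ≥ −∫_{(T₀,T)} Kρ + (c₀/2)ℓ⁻¹ N` is
incompatible with `|G| ≤ M` once `(c₀/2)ℓ⁻¹ N > 2M + ∫ Kρ + 1`. -/
private theorem logWindow_false_of_pos (T₀ T ℓ c₀ K : ℝ) (G q c ρ : ℝ → ℝ) (hT₀T : T₀ < T)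
    (hℓ : 0 < ℓ) (hG : ∀ t ∈ Set.Ioo T₀ T, HasDerivAt G (q t + (ℓ * (T - t))⁻¹ * c t) t)
    (hq : ContinuousOn q (Set.Ioo T₀ T)) (hc : ContinuousOn c (Set.Ioo T₀ T))
    (hGbd : ∃ M : ℝ, ∀ t ∈ Set.Ioo T₀ T, |G t| ≤ M) (hρ : IntegrableOn ρ (Set.Ioo T₀ T))
    (hqb : ∀ t ∈ Set.Ioo T₀ T, |q t| ≤ K * ρ t) (hlim : Tendsto c (𝓝[<] T) (𝓝 c₀))
    (hc₀ : 0 < c₀) : False := by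
  obtain ⟨M, hM⟩ := hGbd
  -- Step 1: a late window `(l, T)` on which `c > c₀ / 2`, and a base point `t₁`.
  have hev : ∀ᶠ t in 𝓝[<] T, c₀ / 2 < c t :=
    hlim.eventually_const_lt (by linarith : c₀ / 2 < c₀)
  obtain ⟨l, hl, hlsub⟩ := mem_nhdsLT_iff_exists_Ioo_subset.1 hev
  have hlT : l < T := hl
  obtain ⟨t₁, hT₁t₁, ht₁T⟩ := exists_between (max_lt hT₀T hlT)
  have hT₀t₁ : T₀ < t₁ := lt_of_le_of_lt (le_max_left _ _) hT₁t₁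
  have hlt₁ : l < t₁ := lt_of_le_of_lt (le_max_right _ _) hT₁t₁
  -- Step 2: the constant `C = ∫_{(T₀,T)} K ρ` and the size `N = n` of the log window.
  have hKρ : IntegrableOn (fun t => K * ρ t) (Set.Ioo T₀ T) := hρ.const_mul K
  obtain ⟨C, hC⟩ : ∃ C : ℝ, C = ∫ t in Set.Ioo T₀ T, K * ρ t := ⟨_, rfl⟩
  have hκ : 0 < c₀ / 2 * ℓ⁻¹ := mul_pos (half_pos hc₀) (inv_pos.2 hℓ)
  obtain ⟨n, hn⟩ := exists_nat_gt ((2 * M + C + 1) / (c₀ / 2 * ℓ⁻¹))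
  have hN : 2 * M + C + 1 < c₀ / 2 * ℓ⁻¹ * n := by
    rw [div_lt_iff₀ hκ] at hn
    linarith
  have hn0 : (0 : ℝ) ≤ n := Nat.cast_nonneg n
  -- Step 3: the end point `t₂ = T - (T - t₁) e^{-n}`.
  obtain ⟨t₂, ht₂⟩ : ∃ t₂ : ℝ, t₂ = T - (T - t₁) * Real.exp (-(n : ℝ)) := ⟨_, rfl⟩
  have hd : 0 < T - t₁ := by linarith
  have hexp_pos : 0 < Real.exp (-(n : ℝ)) := Real.exp_pos _
  have hexp_le : Real.exp (-(n : ℝ)) ≤ 1 := Real.exp_le_one_iff.2 (by linarith)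
  have ht₂T : t₂ < T := by
    have := mul_pos hd hexp_pos
    rw [ht₂]
    linarith
  have ht₁t₂ : t₁ ≤ t₂ := by
    have := mul_le_of_le_one_right hd.le hexp_le
    rw [ht₂]
    linarith
  have hIcc : ∀ t ∈ Icc t₁ t₂, t ∈ Set.Ioo T₀ T := fun t ht =>
    ⟨by linarith [ht.1], by linarith [ht.2]⟩
  have hIcc_sub : Icc t₁ t₂ ⊆ Set.Ioo T₀ T := hIcc
  have hIoc_sub : Ioc t₁ t₂ ⊆ Set.Ioo T₀ T := fun t ht =>
    ⟨by linarith [ht.1], by linarith [ht.2]⟩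
  have hpos : ∀ t ∈ Icc t₁ t₂, 0 < T - t := fun t ht => by linarith [ht.2]
  have hcge : ∀ t ∈ Icc t₁ t₂, c₀ / 2 < c t := fun t ht =>
    hlsub ⟨by linarith [ht.1], by linarith [ht.2]⟩
  -- Step 4: integrability of the pieces on `[t₁, t₂]`.
  have hw_cont : ContinuousOn (fun t : ℝ => (ℓ * (T - t))⁻¹) (Icc t₁ t₂) := by
    refine ContinuousOn.inv₀ (by fun_prop) ?_
    intro t ht
    exact mul_ne_zero hℓ.ne' (hpos t ht).ne'
  have hq_int : IntervalIntegrable q volume t₁ t₂ :=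
    (hq.mono hIcc_sub).intervalIntegrable_of_Icc ht₁t₂
  have hwc_int : IntervalIntegrable (fun t => (ℓ * (T - t))⁻¹ * c t) volume t₁ t₂ :=
    (hw_cont.mul (hc.mono hIcc_sub)).intervalIntegrable_of_Icc ht₁t₂
  have hlow_int : IntervalIntegrable (fun t => c₀ / 2 * (ℓ * (T - t))⁻¹) volume t₁ t₂ :=
    (continuousOn_const.mul hw_cont).intervalIntegrable_of_Icc ht₁t₂
  have hKρ_int : IntervalIntegrable (fun t => K * ρ t) volume t₁ t₂ :=
    (intervalIntegrable_iff_integrableOn_Ioc_of_le ht₁t₂).2 (hKρ.mono_set hIoc_sub)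
  -- Step 5: the fundamental theorem of calculus on `[t₁, t₂]`.
  have hFTC : ∫ t in t₁..t₂, (q t + (ℓ * (T - t))⁻¹ * c t) = G t₂ - G t₁ := by
    apply intervalIntegral.integral_eq_sub_of_hasDerivAt
    · intro t ht
      rw [uIcc_of_le ht₁t₂] at ht
      exact hG t (hIcc t ht)
    · exact hq_int.add hwc_int
  have hsplit : ∫ t in t₁..t₂, (q t + (ℓ * (T - t))⁻¹ * c t) =
      (∫ t in t₁..t₂, q t) + ∫ t in t₁..t₂, (ℓ * (T - t))⁻¹ * c t :=
    intervalIntegral.integral_add hq_int hwc_int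
  -- Step 6: `∫_{t₁}^{t₂} q ≥ -C`.
  have hq_lower : -C ≤ ∫ t in t₁..t₂, q t := by
    have h1 : |∫ t in t₁..t₂, q t| ≤ ∫ t in t₁..t₂, |q t| :=
      intervalIntegral.abs_integral_le_integral_abs ht₁t₂
    have h2 : ∫ t in t₁..t₂, |q t| ≤ ∫ t in t₁..t₂, K * ρ t :=
      intervalIntegral.integral_mono_on ht₁t₂ hq_int.abs hKρ_int (fun t ht => hqb t (hIcc t ht))
    have h3 : ∫ t in t₁..t₂, K * ρ t ≤ C := by
      rw [intervalIntegral.integral_of_le ht₁t₂, hC]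
      refine setIntegral_mono_set hKρ ?_ (LE.le.eventuallyLE hIoc_sub)
      filter_upwards [ae_restrict_mem measurableSet_Ioo] with t ht
      exact (abs_nonneg _).trans (hqb t ht)
    have h4 := (abs_le.1 (h1.trans (h2.trans h3))).1
    linarith
  -- Step 7: `∫_{t₁}^{t₂} (ℓ(T-t))⁻¹ c ≥ (c₀/2) ℓ⁻¹ n`.
  have hI : ∫ t in t₁..t₂, (T - t)⁻¹ = (n : ℝ) := by
    rw [integral_inv_sub_eq_log ht₁t₂ ht₂T]
    have hTt₂ : T - t₂ = (T - t₁) * Real.exp (-(n : ℝ)) := by rw [ht₂]; ring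
    rw [hTt₂, Real.log_mul hd.ne' hexp_pos.ne', Real.log_exp]
    ring
  have hlow : ∫ t in t₁..t₂, c₀ / 2 * (ℓ * (T - t))⁻¹ = c₀ / 2 * ℓ⁻¹ * n := by
    have h1 : ∀ t, c₀ / 2 * (ℓ * (T - t))⁻¹ = (c₀ / 2 * ℓ⁻¹) * (T - t)⁻¹ := fun t => by
      rw [mul_inv]; ring
    simp_rw [h1, intervalIntegral.integral_const_mul, hI]
  have hwc_lower : c₀ / 2 * ℓ⁻¹ * n ≤ ∫ t in t₁..t₂, (ℓ * (T - t))⁻¹ * c t := by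
    rw [← hlow]
    refine intervalIntegral.integral_mono_on ht₁t₂ hlow_int hwc_int (fun t ht => ?_)
    have hw0 : 0 ≤ (ℓ * (T - t))⁻¹ := inv_nonneg.2 (mul_nonneg hℓ.le (hpos t ht).le)
    calc c₀ / 2 * (ℓ * (T - t))⁻¹ ≤ c t * (ℓ * (T - t))⁻¹ :=
          mul_le_mul_of_nonneg_right (hcge t ht).le hw0
      _ = (ℓ * (T - t))⁻¹ * c t := mul_comm _ _
  -- Step 8: contradiction with `|G| ≤ M`.
  have hGt₁ := abs_le.1 (hM t₁ ⟨hT₀t₁, ht₁T⟩)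
  have hGt₂ := abs_le.1 (hM t₂ ⟨by linarith, ht₂T⟩)
  have hmain : G t₂ - G t₁ = (∫ t in t₁..t₂, q t) + ∫ t in t₁..t₂, (ℓ * (T - t))⁻¹ * c t := by
    rw [← hFTC, hsplit]
  linarith [hGt₁.1, hGt₁.2, hGt₂.1, hGt₂.2]

/-- **LOG-WINDOW LEMMA** (stub `stub_logWindow` of crux `NoFrozenEddyCollapse`, line
`SketchIdeator1`; abstract real analysis).  If `G` is bounded on `(T₀, T)` and differentiable there
with `G′(t) = q(t) + (ℓ(T−t))⁻¹ c(t)`, where `q, c` are continuous on `(T₀, T)`, `|q| ≤ K ρ` with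
`ρ` integrable on `(T₀, T)`, and `c(t) → c₀` as `t ↑ T`, then `c₀ = 0`: otherwise
`|G(t₂) − G(t₁)| ≥ (|c₀|/2) ℓ⁻¹ log((T−t₁)/(T−t₂)) − ∫ Kρ → ∞` as `t₂ ↑ T`.  The case `c₀ < 0` is
reduced to `c₀ > 0` by negating `G, q, c`. -/
theorem stub_logWindow :
    ∀ (T₀ T ℓ c₀ K : ℝ) (G q c ρ : ℝ → ℝ), T₀ < T → 0 < ℓ →
      (∀ t ∈ Set.Ioo T₀ T, HasDerivAt G (q t + (ℓ * (T - t))⁻¹ * c t) t) →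
      ContinuousOn q (Set.Ioo T₀ T) → ContinuousOn c (Set.Ioo T₀ T) →
      (∃ M : ℝ, ∀ t ∈ Set.Ioo T₀ T, |G t| ≤ M) →
      IntegrableOn ρ (Set.Ioo T₀ T) → (∀ t ∈ Set.Ioo T₀ T, |q t| ≤ K * ρ t) →
      Tendsto c (nhdsWithin T (Set.Iio T)) (nhds c₀) →
      c₀ = 0 := by
  intro T₀ T ℓ c₀ K G q c ρ hT₀T hℓ hG hq hc hGbd hρ hqb hlim
  by_contra h0
  rcases lt_or_gt_of_ne h0 with hneg | hpos
  · refine logWindow_false_of_pos T₀ T ℓ (-c₀) K (fun t => -G t) (fun t => -q t) (fun t => -c t) ρ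
      hT₀T hℓ ?_ hq.fun_neg hc.fun_neg ?_ hρ ?_ hlim.neg (neg_pos.2 hneg)
    · intro t ht
      exact (hG t ht).fun_neg.congr_deriv (by ring)
    · obtain ⟨M, hM⟩ := hGbd
      exact ⟨M, fun t ht => by simpa only [abs_neg] using hM t ht⟩
    · intro t ht
      simpa only [abs_neg] using hqb t ht
  · exact logWindow_false_of_pos T₀ T ℓ c₀ K G q c ρ hT₀T hℓ hG hq hc hGbd hρ hqb hlim hpos

end Summit.NavierStokesRegularity.NavierStokesRegularity.Theorems.NoFrozenEddyCollapse.ShellBalanceEdgeTorsion
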